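import Literature.Analysis.FluidPDE.TaoForcedBoundedSobolevNormsOfLocalExistence
import Literature.Analysis.FluidPDE.TaoH1LocalExistenceForcedHolds
import HarnessLib

/-!
# Discharge of `tao2011_hasBoundedSobolevNormsOn_forced` (Tao 2013, Thm. 5.4 (iv) with Lemma 8.1,
# WITH a Clay-class force): the «J1» leaf of the cell `ns-blowup`'s E–C lane is a THEOREM

Analysis/FluidPDE proof file (no definitions, no named facts; net debt −1). The named fact
`Literature.Analysis.FluidPDE.tao2011_hasBoundedSobolevNormsOn_forced` (`TaoForcedBoundedSobolevNorms.lean`: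
a classical finite-energy solution of the forced system on a closed slab with Schwartz datum and a
Clay-class force lies in Tao's `L²`-Sobolev class together with `∂ₜu` and the normalised pressure) was
REDUCED by `tao2011_hasBoundedSobolevNormsOn_forced_of_smooth_local_existence`
(`TaoForcedBoundedSobolevNormsOfLocalExistence.lean`, seat `ns-blowup-lit` g10) to the forced local
existence fact `tao2011_smooth_local_existence_forced` (Tao 2013, Thm. 5.4 (ii)+(iv) with forcing),
which is now DISCHARGED (`tao2011_smooth_local_existence_forced_holds`,
`TaoH1LocalExistenceForcedHolds.lean`: the forced Fourier–Picard engine, seats `ns-blowup-lean2` /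
`-lit` / `-lit2` / `-lit3` / `-ecbridge-7`). This file composes the two (turnkey of `ns-blowup-lit`
g10, filed by `ns-blowup-ecbridge-7` g3).

## References

* T. Tao, *Localisation and compactness properties of the Navier–Stokes global regularity problem*,
  Anal. PDE 6 (2013) 25–107 = arXiv:1108.1165, Thm. 5.4 (ii)+(iv), Lemma 8.1. [Tao2011]
-/

noncomputable section

namespace Literature.Analysis.FluidPDE

/-- **Tao 2013, Thm. 5.4 (iv) with Lemma 8.1, WITH a Clay-class force — DISCHARGED**: every
classical finite-energy solution of the forced Navier–Stokes system on a closed slab `[0, T] × ℝ³`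
(`ν > 0`) with Schwartz datum and a Clay-class force, whose pressure is the normalised one, has
bounded `L²` Sobolev norms of every order, and so do `∂ₜu` and `p` (the content of
`tao2011_hasBoundedSobolevNormsOn_forced`). [cite: Tao2011, Thm. 5.4 (ii)+(iv) with Lemma 8.1] -/
theorem tao2011_hasBoundedSobolevNormsOn_forced_holds : tao2011_hasBoundedSobolevNormsOn_forced :=
  tao2011_hasBoundedSobolevNormsOn_forced_of_smooth_local_existence
    tao2011_smooth_local_existence_forced_holds

end Literature.Analysis.FluidPDE

end
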